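import Summits.HodgeConjecture.HodgeConjecture.Theorems.Ring2AbelianAllAndreFibreClassRange
import Summits.HodgeConjecture.HodgeConjecture.Theorems.Ring2HypothesesCMPowerAnchors
import HarnessLib

/-!
# Ring 2 · sub-cell AbelianAll (ALL ABELIAN VARIETIES), André axis, part IX — on the WEIL column `HC_CM` is IDLE:
# compact Weil pencils anchored at a POWER OF A CM ELLIPTIC CURVE (Tate's theorem replaces `HC_CM` at the anchor),
# so β-Lefschetz (or transport) at relative dimension `2n` ALONE gives the Weil classes — `WeilSixfolds` from ONE
# Lefschetz-type statement on 7-folds, with NO `HC_CM` and NO named fact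

HONEST FRAMING (page 1, verbatim): **research route, not a corollary; conditional on HC_CM plus one named
minimal statement.** Cell line: research route conditional on HC_CM; not a corollary; Q11.4-sentence-2
already refuted in dim ≥ 3. Nothing in this file proves a case of the Hodge conjecture: the targets
`WeilTypeLadder.WeilClassesImaginaryQuadratic` (R∞) and `Theses.SevenfoldWeilCensus.WeilSixfolds` (stmt-2524) are
reached CONDITIONALLY on typed OPEN nodes; `HC_CM` (`Theses.RankFourFaces.CMAbelianHodge`) is ABSENT from every
theorem of this part — which is the point: for the Weil column of the sub-cell the hypothesis `HC_CM` of parts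
VII–VIII is IDLE as soon as the CM fibre of the pencil is taken to be a power of a CM elliptic curve (the cell's
KIND bookkeeping: a one-fibre anchor that is an `E`-power makes `HC_CM` idle, RING2-MAP D.58). Seat
`pub-hodge-ring2-ab-andre-2`, gen 2; brief (ii) "minimise … record each version" / (iii) "smallest open instance".

## The habitat, and why every Weil component has an `E`-power point (print + inference, labelled)

For `K = ℚ(√-d)` the polarized abelian `2n`-folds of Weil type of signature `(n,n)` fall into components indexed
by the discriminant `δ = disc H ∈ ℚ^×/N(K^×)` of the `K`-hermitian form (Landherr; Deligne LNM 900 §4; van Geemen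
LNM 1594 5.2–5.12). Take `E = E_K` with complex multiplication by `K`, `A₀ = Eⁿ × Ēⁿ` (`K` acting through `ι` on
`n` factors and through `ῑ` on the other `n`: signature `(n,n)`), with a PRODUCT polarisation of degrees
`m₁, …, m_{2n}`: its hermitian form is `diag(a m₁, …, a m_n, −a m_{n+1}, …, −a m_{2n})`, of discriminant
`(−1)ⁿ ∏ mᵢ mod N(K^×)` — every class is realised (choose `m₁`). INFERENCE (this seat; the same inference is
recorded by the hypotheses seat at `Ring2.Hypotheses.CMPowerPointedWeilFamiliesComponent`, from van Geemen 5.5–5.12):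
EVERY Weil component contains a point isogenous to `E_K^{2n}` — most simply: in van Geemen's construction 5.5–5.8 of
the `n²`-dimensional family of `(V, K, H, Λ)` ("any `(X,K,E)` is a member", 5.3), choose the positive subspace `V₊`
to be `K`-RATIONAL (e.g. spanned by the first `n` vectors of the diagonal basis (5.4.1)); then `V₊`, `V₋` are
`K`-subspaces, `J = ±i` on them, and `X = V_ℝ/Λ` is isogenous to `E_Kⁿ × Ē_Kⁿ` [van Geemen 1994, 5.3–5.8]. With
André's compact curve sections (boundary of
codimension `≥ 2n − 1`, `n ≥ 2`; proof of Lemme 6.3.1, p. 32) this gives the habitat node (W_E)ₙ below: a compact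
pencil of relative dimension `2n` through `A` with a fibre charted by an abelian variety isogenous to a power of a
CM elliptic curve — at which EVERY rational `(n,n)` class is algebraic UNCONDITIONALLY (Tate / van Geemen Thm. 4.3 +
Lemma 3.7: the TREE THEOREM `EllipticCurve.hodgeConjectureFor_of_isIsogenous_powSucc_of_cm`, packaged by the
hypotheses seat as `Ring2.Hypotheses.cmPowerAnchor_valid`). Typed OPEN (no Shimura varieties in the tree); NOT a
case of `HC`; no on-path lemma; used only for `n ≥ 2`.

## Content

* §A (W_E)ₙ `CMPowerAnchoredCompactWeilPencilsAt n`; (W_E)ₙ ⟹ (W)ₙ (`E`-power fibres are CM fibres).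
* §B core lemma WITHOUT `HC_CM`: `(W_E)ₙ ∧ CMAnchoredTransportAtRelDim (2n) ⟹` every rational `(n,n)` Weil class on
  every Weil-type `2n`-fold is algebraic (`mem_algebraicClasses_of_cmPowerWeilPencilsAt_of_transport`).
* §C rows, NO `HC_CM`, NO named fact: `(∀ n ≥ 2, (W_E)ₙ) ∧ (∀ n ≥ 2, (4)_{2n} | (β′)_{2n}) ⟹ R∞`;
  **`(W_E)₃ ∧ FibreClassLefschetzOnAtRelDim 6 ⟹ WeilSixfolds`** — the smallest open instance with `HC_CM` GONE:
  Weil classes on ALL abelian sixfolds of Weil type (every `ℚ(√-d)`, EVERY discriminant, split or not) from one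
  algebraic correspondence per compact `E`-anchored Weil-sixfold pencil `𝒳⁷ → C`. Compare the tree's split-only
  rows through Lemme 6.3.3 (`Deform…_of_splitWeil_of_andre1996_…`, literature fact
  `andre1996_splitWeilClasses_algebraicallyAnchoredPencil`): Lemme 6.3.3's `E`-power point `V₀ ⊗ K` lies on the
  SPLIT component only ("(*)": a maximal isotropic subspace), whereas `E_Kⁿ × Ē_Kⁿ` with a non-principal product
  polarisation reaches every component — so NON-split sixfolds (`WeilTypeLadder.NonsplitSixfolds`) are covered too.
* KIND: on the Weil column, `HC_CM` is idle in the KERNEL (this file) — the transport/β input on CM-pointed pencils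
  of relative dimension `2n` is the whole price; for `HC_AV` (all abelian varieties) parts I–VIII keep `HC_CM`
  load-bearing in the kernel because Lemme 6.3.1's CM fibre is NOT an `E`-power in general (`A₀ × A₀`, `A₀` CM).

References: Andre1996Motifs (Lemme 6.3.1 proof p. 32; Lemme 6.3.3 p. 33: "(ii) X_{s₀} isogène à une puissance d'une
courbe elliptique … tout cycle de Hodge sur une puissance d'une courbe elliptique est algébrique ([KuM91] §2)");
vanGeemen1994HodgeAV (Lemma 3.7, Thm. 4.3, 5.2–5.12); Deligne1982HodgeCycles (§4, §5); Weil1977HodgeRing;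
Milne2020HodgeClassesAV (Rem. 3); Gordon1997 (§3).
-/

noncomputable section

set_option linter.dupNamespace false

namespace Summit.HodgeConjecture.HodgeConjecture.Ring2.AbelianAll

open CategoryTheory AlgebraicGeometry
open Literature.AlgebraicGeometry Literature.AlgebraicGeometry.Motives
open Literature.AlgebraicGeometry.HodgeTheory
open Literature.AlgebraicGeometry.Milne1999 (IsOfCMType)
open Literature.AlgebraicGeometry.Deligne1982 (cmLocus)
open Summit.HodgeConjecture.HodgeConjecture
open Summit.HodgeConjecture.HodgeConjecture.Theses
open Summit.HodgeConjecture.HodgeConjecture.Ring2.Hypotheses (cmPowerLocus cmPowerAnchor_valid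
  isOfCMType_of_isIsogenous_powSucc_of_cm)
open Summit.HodgeConjecture.HodgeConjecture.WeilTypeLadder (WeilClassesImaginaryQuadratic NonsplitSixfolds
  weilSixfolds_iff_weilClassesOf nonsplitSixfolds_of_weilSixfolds)

variable {𝒳 S : SchemeOver ℂ}

/-! ## §A The habitat node: compact Weil pencils anchored at a power of a CM elliptic curve -/

/-- **(W_E)ₙ `CMPowerAnchoredCompactWeilPencilsAt n` — every non-zero Weil class on an abelian `2n`-fold of Weil
type sits on a COMPACT pencil of relative dimension `2n` having a fibre isogenous to a POWER OF A CM ELLIPTIC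
CURVE.** For `0 < d`, `(A, φ)` with `dim A = 2n`, `φ ≫ φ = -(d • 𝟙 A)`, and a rational `(n,n)` class `c ≠ 0` in
`weilClassesOf A φ n d`: a compact pencil of abelian varieties `f : 𝒳 ⟶ S` of relative dimension `2n`, points
`s, t`, a global `W` rational of type `(n,n)` on every fibre, a chart `e₁ : A.X ≅ 𝒳_s` with `e₁^*(W|_{𝒳_s}) = c`,
and `t ∈ Ring2.Hypotheses.cmPowerLocus f (2n)` (the fibre `𝒳_t` is charted by an abelian `2n`-fold isogenous to
`Eᴺ⁺¹`, `E` an elliptic curve with `ψ ≫ ψ = -(d' • 𝟙 E)`, `d' ≥ 1`). In print (INFERENCE from the cited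
constructions, module docstring): `E_Kⁿ × Ē_Kⁿ` with a product polarisation lies on the Weil component of `A`
(every discriminant is realised), and André's compact curve section through the two points exists for `n ≥ 2`.
Typed OPEN; a HYPOTHESIS wherever used; NOT a case of `HC`; no on-path lemma; used only for `n ≥ 2`.
[cite: Andre1996Motifs, proof of Lemme 6.3.1 (p. 32) and Lemme 6.3.3 (ii) (p. 33)]
[cite: vanGeemen1994HodgeAV, 5.2, 5.8 and 5.12] [cite: Deligne1982HodgeCycles, §4 (proof of Thm. 4.8) and §5] -/
@[conjecture] def CMPowerAnchoredCompactWeilPencilsAt (n : ℕ) : Prop :=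
  ∀ (d : ℕ), 0 < d → ∀ (A : AbelianVariety ℂ) (φ : A ⟶ A), A.dim = 2 * n →
    IsSmoothProjective (2 * n) A.X → φ ≫ φ = -(d • 𝟙 A) →
      ∀ c : complexBetti A.X (2 * n), IsRationalClass c → IsOfHodgeType (2 * n) A.X (2 * n) n n c →
        c ∈ weilClassesOf A φ n d → c ≠ 0 →
        ∃ (𝒳 S : SchemeOver ℂ) (f : 𝒳 ⟶ S), IsCompactAbelianPencil f (2 * n) ∧
          ∃ (s t : ComplexPoints S) (W : complexBetti 𝒳 (2 * n)) (e₁ : A.X ≅ fiberOver f s),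
            (∀ s' : ComplexPoints S, IsRationalClass (complexBetti.map (fiberι f s') (2 * n) W) ∧
              IsOfHodgeType (2 * n) (fiberOver f s') (2 * n) n n (complexBetti.map (fiberι f s') (2 * n) W)) ∧
            complexBetti.map e₁.hom (2 * n) (complexBetti.map (fiberι f s) (2 * n) W) = c ∧
            t ∈ cmPowerLocus f (2 * n)

/-- An `E`-power fibre is a CM fibre: `cmPowerLocus f d ⊆ Deligne1982.cmLocus f d` on the carriers of this column
(a power of a CM elliptic curve, and anything isogenous to it, is of CM type — the hypotheses seat's
`isOfCMType_of_isIsogenous_powSucc_of_cm`). [cite: Milne1999, §2 p. 54] [cite: vanGeemen1994HodgeAV, Lemma 3.7] -/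
theorem mem_cmLocus_of_mem_cmPowerLocus {f : 𝒳 ⟶ S} {d : ℕ} {t : ComplexPoints S}
    (ht : t ∈ cmPowerLocus f d) : t ∈ cmLocus f d := by
  obtain ⟨A₀, E, ψ, d', N, he₀, hA₀dim, hE, hd', hψ, hiso⟩ := ht
  exact ⟨A₀, he₀, hA₀dim, isOfCMType_of_isIsogenous_powSucc_of_cm hE ψ hd' hψ N hiso⟩

/-- (W_E)ₙ ⟹ (W)ₙ (part VII's CM-anchored habitat). [folklore] -/
theorem cmAnchoredCompactWeilPencilsAt_of_cmPower {n : ℕ} (h : CMPowerAnchoredCompactWeilPencilsAt n) :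
    CMAnchoredCompactWeilPencilsAt n := by
  intro d hd A φ hAdim hA hφ c hcQ hcH hcW hc0
  obtain ⟨𝒳, S, f, hf, s, t, W, e₁, hWH, hread, ht⟩ := h d hd A φ hAdim hA hφ c hcQ hcH hcW hc0
  obtain ⟨A₀, E, ψ, d', N, he₀, hA₀dim, hE, hd', hψ, hiso⟩ := ht
  exact ⟨𝒳, S, f, hf, s, t, W, e₁, A₀, hWH, hread, he₀, isOfCMType_of_isIsogenous_powSucc_of_cm hE ψ hd' hψ N hiso⟩

/-! ## §B The core lemma WITHOUT `HC_CM` -/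

/-- **Core lemma, NO `HC_CM`.** Under (W_E)ₙ and transport out of CM fibres on compact pencils of relative
dimension `2n` (part IV's `CMAnchoredTransportAtRelDim (2n)`), every rational `(n,n)` Weil class on an abelian
`2n`-fold of Weil type is algebraic: on the pencil of (W_E)ₙ the restriction `W|_{𝒳_t}` to the `E`-power fibre is
algebraic by TATE'S THEOREM (tree: `Ring2.Hypotheses.cmPowerAnchor_valid`, i.e.
`EllipticCurve.hodgeConjectureFor_of_isIsogenous_powSucc_of_cm` + isogeny/chart invariance) — this is where
`HC_CM` used to enter and no longer does —, `t` is a CM point, the transport input carries algebraicity to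
`𝒳_s ≅ A.X`, and the chart reads `c`. NO named fact. [cite: vanGeemen1994HodgeAV, Lemma 3.7 and Thm. 4.3]
[cite: Andre1996Motifs, §6.3 a) and c) (p. 33)] -/
theorem mem_algebraicClasses_of_cmPowerWeilPencilsAt_of_transport {n : ℕ} (hW : CMPowerAnchoredCompactWeilPencilsAt n)
    (hT : CMAnchoredTransportAtRelDim (2 * n)) {d : ℕ} (hd : 0 < d) {A : AbelianVariety ℂ} {φ : A ⟶ A}
    (hAdim : A.dim = 2 * n) (hA : IsSmoothProjective (2 * n) A.X) (hφ : φ ≫ φ = -(d • 𝟙 A))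
    {c : complexBetti A.X (2 * n)} (hcQ : IsRationalClass c) (hcH : IsOfHodgeType (2 * n) A.X (2 * n) n n c)
    (hcW : c ∈ weilClassesOf A φ n d) : c ∈ algebraicClasses A.X n := by
  by_cases hc0 : c = 0
  · rw [hc0]; exact Submodule.zero_mem _
  obtain ⟨𝒳, S, f, hf, s, t, W, e₁, hWH, hread, ht⟩ := hW d hd A φ hAdim hA hφ c hcQ hcH hcW hc0
  have h₀ : complexBetti.map (fiberι f t) (2 * n) W ∈ algebraicClasses (fiberOver f t) n :=
    cmPowerAnchor_valid n (fiberOver f t) _ ht (hWH t).1 (hWH t).2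
  have h₁ := hT f hf n W hWH t (mem_cmLocus_of_mem_cmPowerLocus ht) h₀ s
  rw [← hread]
  exact (mem_algebraicClasses_map_iff_of_iso e₁).2 h₁

/-! ## §C The rows: the Weil column with `HC_CM` gone -/

/-- **R∞ from (W_E) and transport at relative dimension `2n` — NO `HC_CM`, NO named fact.**
[cite: Weil1977HodgeRing] [cite: vanGeemen1994HodgeAV, Thm. 4.3] [cite: Andre1996Motifs, §6.3 (p. 33)] -/
theorem weilClassesImaginaryQuadratic_of_cmPowerWeilPencils_of_transport
    (hW : ∀ n, 2 ≤ n → CMPowerAnchoredCompactWeilPencilsAt n) (hT : ∀ n, 2 ≤ n → CMAnchoredTransportAtRelDim (2 * n)) :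
    WeilClassesImaginaryQuadratic :=
  fun n hn _ hd _ _ hAdim hA hφ _ hcQ hcH hcW ↦
    mem_algebraicClasses_of_cmPowerWeilPencilsAt_of_transport (hW n hn) (hT n hn) hd hAdim hA hφ hcQ hcH hcW

/-- **R∞ from (W_E) and the repaired β-Lefschetz at relative dimension `2n` — NO `HC_CM`, NO named fact.**
[cite: Abdulali1994FamiliesAV, Conjecture 5.3 (p. 1130)] [cite: Andre1996Motifs, Remarque 2 (p. 33)] -/
theorem weilClassesImaginaryQuadratic_of_cmPowerWeilPencils_of_fibreClassLefschetzOn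
    (hW : ∀ n, 2 ≤ n → CMPowerAnchoredCompactWeilPencilsAt n) (hF : ∀ n, 2 ≤ n → FibreClassLefschetzOnAtRelDim (2 * n)) :
    WeilClassesImaginaryQuadratic :=
  weilClassesImaginaryQuadratic_of_cmPowerWeilPencils_of_transport hW
    fun n hn ↦ cmAnchoredTransportAtRelDim_of_fibreClassLefschetzOnAtRelDim (hF n hn)

/-- **THE SMALLEST OPEN INSTANCE with `HC_CM` GONE: `(W_E)₃ ∧ FibreClassLefschetzOnAtRelDim 6 ⟹ WeilSixfolds`**
(item stmt-HodgeConjecture-2524: Weil classes on ALL abelian sixfolds of Weil type — every `ℚ(√-d)`, every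
discriminant, split or not). Price: for each compact `E`-anchored Weil-sixfold pencil `𝒳⁷ → C`, one algebraic
correspondence on the 14-fold `𝒳 × 𝒳` inverting cup-with-the-fibre-class on fibre restrictions (degree `p = 3`
used). NO `HC_CM`, NO named fact; nothing is closed. research route, not a corollary; conditional on HC_CM plus
one named minimal statement (here `HC_CM` is shown IDLE for this row).
[cite: Abdulali1994FamiliesAV, Conjecture 5.3 (p. 1130)] [cite: vanGeemen1994HodgeAV, Thm. 4.3 and 5.12]
[cite: Andre1996Motifs, Lemme 6.3.3 (p. 33) and Remarque 2] -/
theorem weilSixfolds_of_cmPowerWeilPencilsAt_of_fibreClassLefschetzOnAtRelDim_six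
    (hW : CMPowerAnchoredCompactWeilPencilsAt 3) (hF : FibreClassLefschetzOnAtRelDim 6) :
    Theses.SevenfoldWeilCensus.WeilSixfolds :=
  weilSixfolds_iff_weilClassesOf.2 fun _ hd _ _ hAdim hA hφ _ hcQ hcH hcW ↦
    mem_algebraicClasses_of_cmPowerWeilPencilsAt_of_transport hW
      (cmAnchoredTransportAtRelDim_of_fibreClassLefschetzOnAtRelDim hF) hd hAdim hA hφ hcQ hcH hcW

/-- The same with the transport input: `(W_E)₃ ∧ CMAnchoredTransportAtRelDim 6 ⟹ WeilSixfolds`, NO `HC_CM`.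
[cite: vanGeemen1994HodgeAV, Thm. 4.3] [cite: Andre1996Motifs, §6.3 (p. 33)] -/
theorem weilSixfolds_of_cmPowerWeilPencilsAt_of_cmAnchoredTransportAtRelDim_six
    (hW : CMPowerAnchoredCompactWeilPencilsAt 3) (hT : CMAnchoredTransportAtRelDim 6) :
    Theses.SevenfoldWeilCensus.WeilSixfolds :=
  weilSixfolds_iff_weilClassesOf.2 fun _ hd _ _ hAdim hA hφ _ hcQ hcH hcW ↦
    mem_algebraicClasses_of_cmPowerWeilPencilsAt_of_transport hW hT hd hAdim hA hφ hcQ hcH hcW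

/-- In particular the NON-SPLIT sixfolds (`WeilTypeLadder.NonsplitSixfolds`, the part of `W₆` outside Markman's
and Schoen's theorems and outside Lemme 6.3.3's split habitat) follow from the same two hypotheses, NO `HC_CM`.
[cite: Markman2025SurveySecant, §12 (preprint, unrefereed)] [cite: Andre1996Motifs, Lemme 6.3.3 (p. 33)] -/
theorem nonsplitSixfolds_of_cmPowerWeilPencilsAt_of_fibreClassLefschetzOnAtRelDim_six
    (hW : CMPowerAnchoredCompactWeilPencilsAt 3) (hF : FibreClassLefschetzOnAtRelDim 6) : NonsplitSixfolds :=
  nonsplitSixfolds_of_weilSixfolds (weilSixfolds_of_cmPowerWeilPencilsAt_of_fibreClassLefschetzOnAtRelDim_six hW hF)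

/-- **KIND statement for the Weil column, in the Frame's idiom**: given (W_E)₃, the hypothesis `HC_CM` of part
VIII's row `HC_CM ∧ (W)₃ ∧ (β′)_6 ⟹ WeilSixfolds` is IDLE — `(β′)_6` alone gives `WeilSixfolds`. [folklore] -/
theorem weilSixfolds_cmIdle_of_cmPowerWeilPencilsAt (hW : CMPowerAnchoredCompactWeilPencilsAt 3) :
    FibreClassLefschetzOnAtRelDim 6 → Theses.SevenfoldWeilCensus.WeilSixfolds :=
  fun hF ↦ weilSixfolds_of_cmPowerWeilPencilsAt_of_fibreClassLefschetzOnAtRelDim_six hW hF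

end Summit.HodgeConjecture.HodgeConjecture.Ring2.AbelianAll

end
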